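import Mathlib.Topology.ContinuousMap.Weierstrass
import Mathlib.Analysis.Complex.ExponentialBounds
import Mathlib.Analysis.SpecialFunctions.Pow.Real
import Mathlib.Analysis.SpecialFunctions.Pow.Continuity
import HarnessLib

/-!
# Karamata's method: the Hardy–Littlewood Tauberian theorem for generalized Dirichlet series

Topic `Literature/NumberTheory/LFunctions`. Infrastructure for the proof of the named fact
`Literature.NumberTheory.LFunctions.HardyLittlewoodTauberianDirichlet` (`TauberianTheorems.lean`, Montgomery–Vaughan Thm. 5.11),
following Montgomery–Vaughan, *Multiplicative Number Theory I*, §5.2, pp. 123–125. Everything in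
this file is PROVED (no `sorry`); the two results are recorded in the named-fact format
`def X : Prop` + `theorem X_holds : X`.

* `KaramataPolynomials` / `KaramataPolynomials_holds` — MV **Lemma 5.8** (Karamata 1930): for
  `0 < ε < 1/4` there are polynomials `P± ` with `P±(0) = 0`, `P₋ ≤ χ_J ≤ P₊` on `[0,1]`
  (`J = [e⁻¹, 1]`) and `|P±(x) − χ_J(x)| ≤ ε x(1−x) + 5 χ_K(x)`, `K = [e^{-1-ε}, e^{-1+ε}]`.
  Proof as in the book: `χ_J = x + x(1−x) g` with `g` continuous apart from an upward jump of
  height `< 5` at `e⁻¹`; squeeze `g` between continuous envelopes that differ from it only on `K`,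
  and apply Weierstrass (`exists_polynomial_near_of_continuousOn`). We write the envelopes as
  `g₁ + (g₂ − g₁) ρ±` with `g₁ = −1/(1 − min(x, e⁻¹))`, `g₂ = 1/max(x, e⁻¹)` and clamped-linear
  ramps `ρ±`, which avoids case analysis; the book's constant `5` is met with room to spare
  (`g₂ − g₁ ≤ e + e/(e−1) < 5`).
* `HardyLittlewoodTauberianSums` / `HardyLittlewoodTauberianSums_holds` — MV **Theorem 5.7**
  (Hardy–Littlewood 1914, Karamata's proof), case `α = 0`, in *Stieltjes form*: the book runs the
  argument for `I(δ) = ∫₀^∞ a(u) e^{−uδ} du`; we run the identical argument (pp. 124–125) for a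
  generalized Dirichlet series `Σ c_n e^{−δ λ_n}` (`λ_n ≥ 0`), which is what Thm. 5.11 needs
  (`λ_n = log n`), thereby avoiding the smoothing/unsmoothing detour of the book's proof of
  Thm. 5.11 (p. 125–126). The Tauberian condition is `c_n ≥ −w_n` for a nonnegative weight `w`
  subject to the two estimates the book verifies for `w(u) = A(u+1)^{β−1}` on p. 124
  (`Σ w_n e^{−λ_n/U}(1 − e^{−λ_n/U}) ≪ U^β` and `Σ_{(1−ε)U ≤ λ_n ≤ (1+ε)U} w_n ≪ ε U^β`); the
  conclusion is `Σ_{λ_n ≤ U} c_n = o(U^β)`. Key steps: `Σ_{λ_n ≤ U} c_n = Σ c_n χ_J(e^{−λ_n/U})`,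
  `Σ c_n P(e^{−λ_n/U}) = Σ_r p_r Σ c_n e^{−(r/U)λ_n} = o(U^β)` ((5.43)), and the sandwich
  `c χ_J ≤ c P₊ + w (P₊ − χ_J)`, `c χ_J ≥ c P₋ − w (χ_J − P₋)`.

The reduction of the general case (`α ≠ 0`, main terms, `Γ(β+1)`) and the verification of the
weight estimates for `λ_n = log n`, `w_n = (K + log n)^{β−1}/n` are carried out in
`TauberianTheoremsProofs.lean`.

## References

* H. L. Montgomery, R. C. Vaughan, *Multiplicative Number Theory I. Classical Theory*, Cambridge
  Stud. Adv. Math. 97, CUP 2007, §5.2: Lemma 5.8 (p. 124), Theorem 5.7 (pp. 123–125).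
  [cite: MontgomeryVaughan2007]
* J. Karamata, Über die Hardy–Littlewoodschen Umkehrungen des Abelschen Stetigkeitssatzes,
  Math. Z. 32 (1930) 319–320 (the polynomial-approximation method).
-/

noncomputable section

open Filter Set Polynomial
open scoped Topology

namespace Literature.NumberTheory.LFunctions

namespace Karamata

/-- Indicator of `J = [e⁻¹, 1]` (used only on `[0, 1]`): `χ_J x = 1` if `e⁻¹ ≤ x`, else `0`.
[cite: MontgomeryVaughan2007, Lemma 5.8] -/
def chiJ (x : ℝ) : ℝ := if Real.exp (-1) ≤ x then 1 else 0

/-- Indicator of `K = [e^{-1-ε}, e^{-1+ε}]`. [cite: MontgomeryVaughan2007, Lemma 5.8] -/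
def chiK (ε x : ℝ) : ℝ := if Real.exp (-1 - ε) ≤ x ∧ x ≤ Real.exp (-1 + ε) then 1 else 0

/-- Auxiliary (`chiJ_of_le`). [folklore] -/
lemma chiJ_of_le {x : ℝ} (h : Real.exp (-1) ≤ x) : chiJ x = 1 := if_pos h

/-- Auxiliary (`chiJ_of_lt`). [folklore] -/
lemma chiJ_of_lt {x : ℝ} (h : x < Real.exp (-1)) : chiJ x = 0 := if_neg (not_le.mpr h)

/-- Auxiliary (`chiK_nonneg`). [folklore] -/
lemma chiK_nonneg (ε x : ℝ) : 0 ≤ chiK ε x := by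
  unfold chiK; split_ifs <;> norm_num

/-- Auxiliary (`chiK_of_mem`). [folklore] -/
lemma chiK_of_mem {ε x : ℝ} (h1 : Real.exp (-1 - ε) ≤ x) (h2 : x ≤ Real.exp (-1 + ε)) :
    chiK ε x = 1 := if_pos ⟨h1, h2⟩

/-- `g₁ x = -1/(1 - min x e⁻¹)`: equals `-1/(1-x)` left of `e⁻¹`, continuous on `ℝ`. [folklore] -/
def g₁ (x : ℝ) : ℝ := -1 / (1 - min x (Real.exp (-1)))

/-- `g₂ x = 1/max x e⁻¹`: equals `1/x` right of `e⁻¹`, continuous on `ℝ`. [folklore] -/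
def g₂ (x : ℝ) : ℝ := 1 / max x (Real.exp (-1))

/-- Auxiliary (`exp_neg_one_lt_one`). [folklore] -/
lemma exp_neg_one_lt_one : Real.exp (-1) < 1 := by
  have := Real.exp_neg_one_lt_half; linarith

/-- Auxiliary (`continuous_g₁`). [folklore] -/
lemma continuous_g₁ : Continuous g₁ := by
  unfold g₁
  refine continuous_const.div (by fun_prop) fun x => ?_
  have : min x (Real.exp (-1)) ≤ Real.exp (-1) := min_le_right _ _
  have := exp_neg_one_lt_one
  linarith

/-- Auxiliary (`continuous_g₂`). [folklore] -/
lemma continuous_g₂ : Continuous g₂ := by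
  unfold g₂
  refine continuous_const.div (by fun_prop) fun x => ?_
  have : Real.exp (-1) ≤ max x (Real.exp (-1)) := le_max_right _ _
  have := Real.exp_pos (-1)
  linarith

/-- On `[0, 1]`: `0 ≤ g₂ - g₁ ≤ 5` (crudely: `e ≤ 3`, `1/(1 - e⁻¹) ≤ 2`). [folklore] -/
lemma g₂_sub_g₁_mem {x : ℝ} (hx0 : 0 ≤ x) : 0 ≤ g₂ x - g₁ x ∧ g₂ x - g₁ x ≤ 5 := by
  have he := Real.exp_pos (-1)
  have he1 := exp_neg_one_lt_one
  have hehalf := Real.exp_neg_one_lt_half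
  have hmax : Real.exp (-1) ≤ max x (Real.exp (-1)) := le_max_right _ _
  have hmin : min x (Real.exp (-1)) ≤ Real.exp (-1) := min_le_right _ _
  have hmin0 : 0 ≤ min x (Real.exp (-1)) := le_min hx0 he.le
  have h2 : 0 < g₂ x := by unfold g₂; positivity
  have h1 : g₁ x < 0 := by
    unfold g₁; exact div_neg_of_neg_of_pos (by norm_num) (by linarith)
  refine ⟨by linarith, ?_⟩
  have h2' : g₂ x ≤ 3 := by
    unfold g₂
    rw [div_le_iff₀ (by linarith)]
    -- 1 ≤ 3 * max x e⁻¹, since e⁻¹ > 1/3 (e < 3)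
    have : (1 : ℝ) / 3 < Real.exp (-1) := by
      rw [Real.exp_neg, ← one_div]
      exact one_div_lt_one_div_of_lt (Real.exp_pos 1) Real.exp_one_lt_three
    linarith
  have h1' : -2 ≤ g₁ x := by
    unfold g₁
    rw [le_div_iff₀ (by linarith)]
    linarith
  linarith

/-- The function `g = (χ_J - x)/(x(1-x))` of the source, written as `g₁ + (g₂ - g₁) χ_J`.
[cite: MontgomeryVaughan2007, Lemma 5.8 (proof)] -/
def g (x : ℝ) : ℝ := g₁ x + (g₂ x - g₁ x) * chiJ x

/-- Key identity: `χ_J(x) = x + x(1-x) g(x)` on `[0, 1]`. [folklore] -/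
lemma chiJ_eq (x : ℝ) : chiJ x = x + x * (1 - x) * g x := by
  unfold g
  by_cases h : Real.exp (-1) ≤ x
  · have hx : x ≠ 0 := (lt_of_lt_of_le (Real.exp_pos _) h).ne'
    rw [chiJ_of_le h]
    simp only [mul_one, add_sub_cancel, g₂, max_eq_left h]
    field_simp
    ring
  · push Not at h
    have hx : 1 - x ≠ 0 := by have := exp_neg_one_lt_one; linarith
    rw [chiJ_of_lt h]
    simp only [mul_zero, add_zero, g₁, min_eq_left h.le]
    field_simp
    ring

/-- One-sided Weierstrass step: given a continuous `ρ` agreeing with `χ_J` off `K` and a shift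
`s`, a polynomial `P` with `P(0) = 0` and
`P(x) - χ_J(x) = x(1-x) (q + (g₂ - g₁)(ρ - χ_J))` with `|q - s| < η` on `[0,1]`. [folklore] -/
lemma envelope (η s : ℝ) (hη : 0 < η) (ρ : ℝ → ℝ) (hρ : Continuous ρ) :
    ∃ P : ℝ[X], P.eval 0 = 0 ∧ ∀ x ∈ Icc (0 : ℝ) 1, ∃ q : ℝ, |q - s| < η ∧
      P.eval x - chiJ x = x * (1 - x) * (q + (g₂ x - g₁ x) * (ρ x - chiJ x)) := by
  set h : ℝ → ℝ := fun x => g₁ x + (g₂ x - g₁ x) * ρ x + s with hh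
  have hc : ContinuousOn h (Icc 0 1) :=
    ((continuous_g₁.add ((continuous_g₂.sub continuous_g₁).mul hρ)).add
      continuous_const).continuousOn
  obtain ⟨Q, hQ⟩ := exists_polynomial_near_of_continuousOn 0 1 h hc η hη
  refine ⟨X + X * (1 - X) * Q, by simp, fun x hx => ⟨Q.eval x - (h x - s), ?_, ?_⟩⟩
  · have := hQ x hx
    rwa [show Q.eval x - (h x - s) - s = Q.eval x - h x by ring]
  have := chiJ_eq x
  simp only [g] at this
  simp only [eval_add, eval_mul, eval_sub, eval_X, eval_one, hh]
  linear_combination -this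

/-- Auxiliary (`exp_lt_exp_neg_one`). [folklore] -/
lemma exp_lt_exp_neg_one {ε : ℝ} (hε : 0 < ε) : Real.exp (-1 - ε) < Real.exp (-1) :=
  Real.exp_lt_exp.mpr (by linarith)

/-- Auxiliary (`exp_neg_one_lt_exp`). [folklore] -/
lemma exp_neg_one_lt_exp {ε : ℝ} (hε : 0 < ε) : Real.exp (-1) < Real.exp (-1 + ε) :=
  Real.exp_lt_exp.mpr (by linarith)

/-- Clamped linear ramp from `0` at `a` to `1` at `b`. [folklore] -/
def ramp (a b x : ℝ) : ℝ := min 1 (max 0 ((x - a) / (b - a)))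

/-- Auxiliary (`continuous_ramp`). [folklore] -/
lemma continuous_ramp (a b : ℝ) : Continuous (ramp a b) := by unfold ramp; fun_prop

/-- Auxiliary (`ramp_mem`). [folklore] -/
lemma ramp_mem (a b x : ℝ) : 0 ≤ ramp a b x ∧ ramp a b x ≤ 1 :=
  ⟨le_min zero_le_one (le_max_left _ _), min_le_left _ _⟩

/-- Auxiliary (`ramp_of_le_left`). [folklore] -/
lemma ramp_of_le_left {a b x : ℝ} (hab : a < b) (hx : x ≤ a) : ramp a b x = 0 := by
  unfold ramp
  have : (x - a) / (b - a) ≤ 0 := div_nonpos_of_nonpos_of_nonneg (by linarith) (by linarith)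
  rw [max_eq_left this, min_eq_right zero_le_one]

/-- Auxiliary (`ramp_of_right_le`). [folklore] -/
lemma ramp_of_right_le {a b x : ℝ} (hab : a < b) (hx : b ≤ x) : ramp a b x = 1 := by
  unfold ramp
  have : 1 ≤ (x - a) / (b - a) := by rw [le_div_iff₀ (by linarith)]; linarith
  rw [max_eq_right (zero_le_one.trans this), min_eq_left this]

end Karamata

open Karamata in
/-- NAMED FACT (proved below) — **Karamata's one-sided polynomial approximation**
(Montgomery–Vaughan 2007, Lemma 5.8): for `0 < ε < 1/4`, with `J = [e⁻¹, 1]`,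
`K = [e^{-1-ε}, e^{-1+ε}]`, there are real polynomials `P₋, P₊` vanishing at `0` with
`P₋(x) ≤ χ_J(x) ≤ P₊(x)` and `|P±(x) - χ_J(x)| ≤ ε x(1-x) + 5 χ_K(x)` for `0 ≤ x ≤ 1`.
(The vanishing at `0` is implicit in the source: `P± = x + x(1-x)Q±`.)
[cite: MontgomeryVaughan2007, Lemma 5.8] -/
def KaramataPolynomials : Prop :=
  ∀ ε : ℝ, 0 < ε → ε < 1 / 4 → ∃ Pm Pp : ℝ[X], Pm.eval 0 = 0 ∧ Pp.eval 0 = 0 ∧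
    ∀ x ∈ Icc (0 : ℝ) 1, Pm.eval x ≤ chiJ x ∧ chiJ x ≤ Pp.eval x ∧
      |Pm.eval x - chiJ x| ≤ ε * (x * (1 - x)) + 5 * chiK ε x ∧
      |Pp.eval x - chiJ x| ≤ ε * (x * (1 - x)) + 5 * chiK ε x

open Karamata in
/-- Proof of `KaramataPolynomials` (MV Lemma 5.8), via continuous one-sided envelopes of
`g = (χ_J - x)/(x(1-x))` and the Weierstrass approximation theorem.
[cite: MontgomeryVaughan2007, Lemma 5.8] -/
theorem KaramataPolynomials_holds : KaramataPolynomials := by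
  intro ε hε _hε4
  have hη : 0 < ε / 2 := by positivity
  set a := Real.exp (-1 - ε)
  set e₁ := Real.exp (-1)
  set b := Real.exp (-1 + ε)
  have hab : a < e₁ := exp_lt_exp_neg_one hε
  have heb : e₁ < b := exp_neg_one_lt_exp hε
  -- lower envelope: ramp on [e₁, b]; upper envelope: ramp on [a, e₁]
  obtain ⟨Pm, hPm0, hPm⟩ := envelope (ε / 2) (-(ε / 2)) hη (ramp e₁ b) (continuous_ramp _ _)
  obtain ⟨Pp, hPp0, hPp⟩ := envelope (ε / 2) (ε / 2) hη (ramp a e₁) (continuous_ramp _ _)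
  refine ⟨Pm, Pp, hPm0, hPp0, fun x hx => ?_⟩
  obtain ⟨qm, hqm, hPmx⟩ := hPm x hx
  obtain ⟨qp, hqp, hPpx⟩ := hPp x hx
  rw [abs_lt] at hqm hqp
  obtain ⟨hD0, hD5⟩ := g₂_sub_g₁_mem hx.1
  have hxx : 0 ≤ x * (1 - x) := mul_nonneg hx.1 (by linarith [hx.2])
  have hxx1 : x * (1 - x) ≤ 1 := by nlinarith [hx.1, hx.2]
  have hK0 := chiK_nonneg ε x
  -- the sign and size of ρ - χ_J for both ramps
  have hρm : ramp e₁ b x - chiJ x ≤ 0 ∧ -chiK ε x ≤ ramp e₁ b x - chiJ x := by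
    by_cases h1 : e₁ ≤ x
    · rw [chiJ_of_le h1]
      by_cases h2 : x ≤ b
      · rw [chiK_of_mem (hab.le.trans h1) h2]
        have := ramp_mem e₁ b x
        constructor <;> linarith
      · push Not at h2
        rw [ramp_of_right_le heb h2.le]
        constructor <;> linarith
    · push Not at h1
      rw [chiJ_of_lt h1, ramp_of_le_left heb h1.le]
      constructor <;> linarith
  have hρp : 0 ≤ ramp a e₁ x - chiJ x ∧ ramp a e₁ x - chiJ x ≤ chiK ε x := by
    by_cases h1 : e₁ ≤ x
    · rw [chiJ_of_le h1, ramp_of_right_le hab h1]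
      constructor <;> linarith
    · push Not at h1
      rw [chiJ_of_lt h1]
      by_cases h2 : a ≤ x
      · rw [chiK_of_mem h2 (h1.le.trans heb.le)]
        have := ramp_mem a e₁ x
        constructor <;> linarith
      · push Not at h2
        rw [ramp_of_le_left hab h2.le]
        constructor <;> linarith
  -- assemble
  have hm1 : (g₂ x - g₁ x) * (ramp e₁ b x - chiJ x) ≤ 0 :=
    mul_nonpos_of_nonneg_of_nonpos hD0 hρm.1
  have hm2 : -(5 * chiK ε x) ≤ (g₂ x - g₁ x) * (ramp e₁ b x - chiJ x) := by
    nlinarith [hρm.2, hD5, hD0, hK0]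
  have hp1 : 0 ≤ (g₂ x - g₁ x) * (ramp a e₁ x - chiJ x) := mul_nonneg hD0 hρp.1
  have hp2 : (g₂ x - g₁ x) * (ramp a e₁ x - chiJ x) ≤ 5 * chiK ε x := by
    nlinarith [hρp.2, hD5, hD0, hK0]
  have hPm_le : Pm.eval x - chiJ x ≤ 0 := by
    rw [hPmx]; exact mul_nonpos_of_nonneg_of_nonpos hxx (by linarith)
  have hPm_ge : -(ε * (x * (1 - x)) + 5 * chiK ε x) ≤ Pm.eval x - chiJ x := by
    rw [hPmx]; nlinarith
  have hPp_ge : 0 ≤ Pp.eval x - chiJ x := by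
    rw [hPpx]; exact mul_nonneg hxx (by linarith)
  have hPp_le : Pp.eval x - chiJ x ≤ ε * (x * (1 - x)) + 5 * chiK ε x := by
    rw [hPpx]; nlinarith
  refine ⟨by linarith, by linarith, ?_, ?_⟩
  · rw [abs_le]; exact ⟨hPm_ge, by linarith⟩
  · rw [abs_le]; exact ⟨by linarith, hPp_le⟩

namespace Karamata

/-! ### The discrete Karamata argument -/

variable {lam c w : ℕ → ℝ}

/-- `x_n(U) = e^{-λ_n/U}`. [folklore] -/
def xU (lam : ℕ → ℝ) (U : ℝ) (n : ℕ) : ℝ := Real.exp (-(lam n / U))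

/-- Auxiliary (`xU_mem`). [folklore] -/
lemma xU_mem (hlam : ∀ n, 0 ≤ lam n) {U : ℝ} (hU : 0 < U) (n : ℕ) : xU lam U n ∈ Icc (0 : ℝ) 1 := by
  refine ⟨(Real.exp_pos _).le, ?_⟩
  unfold xU
  rw [Real.exp_le_one_iff]
  have := div_nonneg (hlam n) hU.le
  linarith

/-- Auxiliary (`xU_pow`). [folklore] -/
lemma xU_pow (lam : ℕ → ℝ) (U : ℝ) (n r : ℕ) :
    xU lam U n ^ r = Real.exp (-((r : ℝ) / U * lam n)) := by
  unfold xU; rw [← Real.exp_nat_mul]; congr 1; ring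

/-- Auxiliary (`chiJ_xU`). [folklore] -/
lemma chiJ_xU {U : ℝ} (hU : 0 < U) (n : ℕ) :
    chiJ (xU lam U n) = if lam n ≤ U then 1 else 0 := by
  unfold chiJ xU
  have : Real.exp (-1) ≤ Real.exp (-(lam n / U)) ↔ lam n ≤ U := by
    rw [Real.exp_le_exp, neg_le_neg_iff, div_le_one hU]
  by_cases h : lam n ≤ U
  · rw [if_pos (this.mpr h), if_pos h]
  · rw [if_neg (fun h' => h (this.mp h')), if_neg h]

/-- Auxiliary (`chiK_xU`). [folklore] -/
lemma chiK_xU {U : ℝ} (hU : 0 < U) (ε : ℝ) (n : ℕ) :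
    chiK ε (xU lam U n) = if (1 - ε) * U ≤ lam n ∧ lam n ≤ (1 + ε) * U then 1 else 0 := by
  unfold chiK xU
  have h1 : Real.exp (-1 - ε) ≤ Real.exp (-(lam n / U)) ↔ lam n ≤ (1 + ε) * U := by
    rw [Real.exp_le_exp, show -1 - ε = -(1 + ε) by ring, neg_le_neg_iff, div_le_iff₀ hU]
  have h2 : Real.exp (-(lam n / U)) ≤ Real.exp (-1 + ε) ↔ (1 - ε) * U ≤ lam n := by
    rw [Real.exp_le_exp, show -1 + ε = -(1 - ε) by ring, neg_le_neg_iff, le_div_iff₀ hU]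
  by_cases h : (1 - ε) * U ≤ lam n ∧ lam n ≤ (1 + ε) * U
  · rw [if_pos ⟨h1.mpr h.2, h2.mpr h.1⟩, if_pos h]
  · rw [if_neg (fun h' => h ⟨h2.mp h'.2, h1.mp h'.1⟩), if_neg h]

/-- `Σ c_n P(x_n) = Σ_r p_r Σ_n c_n e^{-(r/U)λ_n}` for a polynomial `P` with `P(0) = 0`.
[folklore] -/
lemma tsum_mul_eval (P : ℝ[X]) (hP0 : P.eval 0 = 0)
    (hcs : ∀ δ : ℝ, 0 < δ → Summable fun n => c n * Real.exp (-(δ * lam n)))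
    {U : ℝ} (hU : 0 < U) :
    Summable (fun n => c n * P.eval (xU lam U n)) ∧
      ∑' n, c n * P.eval (xU lam U n) = ∑ r ∈ Finset.range (P.natDegree + 1),
        P.coeff r * ∑' n, c n * Real.exp (-((r : ℝ) / U * lam n)) := by
  have hterm : ∀ r ∈ Finset.range (P.natDegree + 1),
      Summable (fun n => P.coeff r * (c n * Real.exp (-((r : ℝ) / U * lam n)))) := by
    intro r _
    rcases Nat.eq_zero_or_pos r with rfl | hr
    · have : P.coeff 0 = 0 := by rwa [Polynomial.coeff_zero_eq_eval_zero]
      simp only [this, zero_mul]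
      exact summable_zero
    · exact (hcs _ (by positivity)).mul_left _
  have hpt : (fun n => c n * P.eval (xU lam U n)) = fun n => ∑ r ∈ Finset.range (P.natDegree + 1),
      P.coeff r * (c n * Real.exp (-((r : ℝ) / U * lam n))) := by
    ext n
    rw [Polynomial.eval_eq_sum_range, Finset.mul_sum]
    refine Finset.sum_congr rfl fun r _ => ?_
    rw [xU_pow]; ring
  rw [hpt]
  refine ⟨summable_sum hterm, ?_⟩
  rw [Summable.tsum_finsetSum hterm]
  refine Finset.sum_congr rfl fun r _ => ?_
  rw [tsum_mul_left]

/-- (5.43): `U^{-β} Σ c_n P(e^{-λ_n/U}) → 0` when `δ^β Σ c_n e^{-δλ_n} → 0` and `P(0) = 0`.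
[cite: MontgomeryVaughan2007, (5.43) p. 124] -/
lemma tendsto_tsum_mul_eval_div {β : ℝ} (P : ℝ[X]) (hP0 : P.eval 0 = 0)
    (hcs : ∀ δ : ℝ, 0 < δ → Summable fun n => c n * Real.exp (-(δ * lam n)))
    (hlim : Tendsto (fun δ : ℝ => δ ^ β * ∑' n, c n * Real.exp (-(δ * lam n))) (𝓝[>] 0) (𝓝 0)) :
    Tendsto (fun U : ℝ => (∑' n, c n * P.eval (xU lam U n)) / U ^ β) atTop (𝓝 0) := by
  have key : ∀ r : ℕ, 0 < r → Tendsto (fun U : ℝ =>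
      (∑' n, c n * Real.exp (-((r : ℝ) / U * lam n))) / U ^ β) atTop (𝓝 0) := by
    intro r hr
    have hr0 : (0 : ℝ) < r := Nat.cast_pos.mpr hr
    have hδ : Tendsto (fun U : ℝ => (r : ℝ) / U) atTop (𝓝[>] 0) := by
      rw [tendsto_nhdsWithin_iff]
      refine ⟨tendsto_const_nhds.div_atTop tendsto_id, ?_⟩
      filter_upwards [eventually_gt_atTop 0] with U hU
      exact div_pos hr0 hU
    have h2 := (hlim.comp hδ).const_mul (((r : ℝ) ^ β)⁻¹)
    rw [mul_zero] at h2
    refine h2.congr' ?_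
    filter_upwards [eventually_gt_atTop 0] with U hU
    simp only [Function.comp_def]
    rw [Real.div_rpow hr0.le hU.le]
    have hr' : (r : ℝ) ^ β ≠ 0 := (Real.rpow_pos_of_pos hr0 β).ne'
    have hU' : U ^ β ≠ 0 := (Real.rpow_pos_of_pos hU β).ne'
    field_simp
  have hev : ∀ᶠ U : ℝ in atTop, (∑ r ∈ Finset.range (P.natDegree + 1),
      P.coeff r * ((∑' n, c n * Real.exp (-((r : ℝ) / U * lam n))) / U ^ β)) =
      (∑' n, c n * P.eval (xU lam U n)) / U ^ β := by
    filter_upwards [eventually_gt_atTop 0] with U hU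
    rw [(tsum_mul_eval P hP0 hcs hU).2, Finset.sum_div]
    refine Finset.sum_congr rfl fun r _ => ?_
    ring
  refine Tendsto.congr' hev ?_
  rw [show (0 : ℝ) = ∑ r ∈ Finset.range (P.natDegree + 1), P.coeff r * 0 by simp]
  refine tendsto_finsetSum _ fun r _ => ?_
  rcases Nat.eq_zero_or_pos r with rfl | hr
  · have : P.coeff 0 = 0 := by rwa [Polynomial.coeff_zero_eq_eval_zero]
    simp only [this, zero_mul]
    exact tendsto_const_nhds
  · exact (key r hr).const_mul _

end Karamata

/-- NAMED FACT (proved below) — **Hardy–Littlewood–Karamata Tauberian theorem, Stieltjes /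
generalized-Dirichlet-series form** (the argument of Montgomery–Vaughan 2007, Thm. 5.7 and its
proof, pp. 123–125, run on the sums `Σ c_n e^{-δλ_n}` instead of the Laplace integral
`∫ a(u)e^{-uδ} du`, case `α = 0`). Let `λ_n ≥ 0`, `c_n ≥ -w_n` with `w_n ≥ 0`, and suppose
`Σ c_n e^{-δλ_n}`, `Σ w_n e^{-δλ_n}` converge for every `δ > 0` and
`δ^β Σ c_n e^{-δλ_n} → 0` as `δ → 0⁺` (`β ≥ 0`). Suppose the weights satisfy the two estimates
that MV verify for `w(u) = A(u+1)^{β-1}` on p. 124: for all large `U`,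
`Σ w_n e^{-λ_n/U}(1 - e^{-λ_n/U}) ≤ C U^β`, and for each `0 < ε < 1/4`, for all large `U`,
`Σ_{(1-ε)U ≤ λ_n ≤ (1+ε)U} w_n ≤ C ε U^β`. Then `U^{-β} Σ_{λ_n ≤ U} c_n → 0` as `U → ∞`.
[cite: MontgomeryVaughan2007, Thm. 5.7 (proof, pp. 123–125)] -/
def HardyLittlewoodTauberianSums : Prop :=
  ∀ (lam c w : ℕ → ℝ) (β C : ℝ), 0 ≤ β →
    (∀ n, 0 ≤ lam n) → (∀ n, 0 ≤ w n) → (∀ n, -w n ≤ c n) →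
    (∀ δ : ℝ, 0 < δ → Summable fun n => c n * Real.exp (-(δ * lam n))) →
    (∀ δ : ℝ, 0 < δ → Summable fun n => w n * Real.exp (-(δ * lam n))) →
    Tendsto (fun δ : ℝ => δ ^ β * ∑' n, c n * Real.exp (-(δ * lam n))) (𝓝[>] 0) (𝓝 0) →
    (∀ᶠ U : ℝ in atTop,
      ∑' n, w n * (Real.exp (-(lam n / U)) * (1 - Real.exp (-(lam n / U)))) ≤ C * U ^ β) →
    (∀ ε : ℝ, 0 < ε → ε < 1 / 4 → ∀ᶠ U : ℝ in atTop,
      ∑' n, (if (1 - ε) * U ≤ lam n ∧ lam n ≤ (1 + ε) * U then w n else 0) ≤ C * ε * U ^ β) →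
    Tendsto (fun U : ℝ => (∑' n, if lam n ≤ U then c n else 0) / U ^ β) atTop (𝓝 0)

open Karamata in
/-- Proof of `HardyLittlewoodTauberianSums`: Karamata's method (MV pp. 124–125) with the
polynomials of `KaramataPolynomials_holds`. [cite: MontgomeryVaughan2007, Thm. 5.7 (proof)] -/
theorem HardyLittlewoodTauberianSums_holds : HardyLittlewoodTauberianSums := by
  intro lam c w β C hβ hlam hw hcw hcs hws hlim hE1 hE2
  -- normalise the constant to be positive
  set C₁ := max C 1 with hC₁
  have hC₁1 : 1 ≤ C₁ := le_max_right _ _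
  have hC₁0 : 0 < C₁ := by linarith
  have hE1' : ∀ᶠ U : ℝ in atTop,
      ∑' n, w n * (xU lam U n * (1 - xU lam U n)) ≤ C₁ * U ^ β := by
    filter_upwards [hE1, eventually_gt_atTop 0] with U h hU
    exact h.trans (mul_le_mul_of_nonneg_right (le_max_left _ _) (Real.rpow_nonneg hU.le _))
  have hE2' : ∀ ε : ℝ, 0 < ε → ε < 1 / 4 → ∀ᶠ U : ℝ in atTop,
      ∑' n, (if (1 - ε) * U ≤ lam n ∧ lam n ≤ (1 + ε) * U then w n else 0) ≤ C₁ * ε * U ^ β := by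
    intro ε hε hε4
    filter_upwards [hE2 ε hε hε4, eventually_gt_atTop 0] with U h hU
    refine h.trans ?_
    gcongr
    exact le_max_left _ _
  refine Metric.tendsto_nhds.mpr fun η hη => ?_
  set ε := min (1 / 8) (η / (8 * C₁)) with hε
  have hε0 : 0 < ε := lt_min (by norm_num) (by positivity)
  have hε4 : ε < 1 / 4 := (min_le_left _ _).trans_lt (by norm_num)
  have hεη : 8 * C₁ * ε ≤ η := by
    have : ε ≤ η / (8 * C₁) := min_le_right _ _
    rwa [le_div_iff₀ (by positivity), mul_comm] at this
  obtain ⟨Pm, Pp, hPm0, hPp0, hP⟩ := KaramataPolynomials_holds ε hε0 hε4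
  have hTm := tendsto_tsum_mul_eval_div Pm hPm0 hcs hlim
  have hTp := tendsto_tsum_mul_eval_div Pp hPp0 hcs hlim
  have h8 : 0 < η / 8 := by positivity
  filter_upwards [eventually_gt_atTop 0, hE1', hE2' ε hε0 hε4, Metric.tendsto_nhds.mp hTm _ h8,
    Metric.tendsto_nhds.mp hTp _ h8] with U hU hE1U hE2U hTmU hTpU
  rw [Real.dist_0_eq_abs, abs_lt] at hTmU hTpU ⊢
  have hUβ : 0 < U ^ β := Real.rpow_pos_of_pos hU β
  set x := xU lam U with hx
  have hxmem : ∀ n, x n ∈ Icc (0 : ℝ) 1 := xU_mem hlam hU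
  -- the truncated sum is `Σ c_n χ_J(x_n)`
  have hSJ : (∑' n, if lam n ≤ U then c n else 0) = ∑' n, c n * chiJ (x n) := by
    refine tsum_congr fun n => ?_
    rw [hx, chiJ_xU hU]
    split_ifs <;> simp
  have hSK : (∑' n, w n * chiK ε (x n)) =
      ∑' n, (if (1 - ε) * U ≤ lam n ∧ lam n ≤ (1 + ε) * U then w n else 0) := by
    refine tsum_congr fun n => ?_
    rw [hx, chiK_xU hU]
    split_ifs <;> simp
  -- summability of everything in sight
  have hexp1 : ∀ n, x n = Real.exp (-(U⁻¹ * lam n)) := by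
    intro n; rw [hx]; unfold xU; congr 1; ring
  have hsJ : Summable fun n => c n * chiJ (x n) := by
    refine Summable.of_norm_bounded (((hcs 1 one_pos).abs).mul_right (Real.exp U)) fun n => ?_
    rw [hx, chiJ_xU hU]
    split_ifs with h
    · rw [mul_one, Real.norm_eq_abs, abs_mul, Real.abs_exp, mul_assoc,
        ← Real.exp_add]
      have : 1 ≤ Real.exp (-(1 * lam n) + U) := Real.one_le_exp_iff.mpr (by linarith)
      nlinarith [abs_nonneg (c n)]
    · simp only [mul_zero, norm_zero]
      positivity
  have hsPp : Summable fun n => c n * Pp.eval (x n) := (tsum_mul_eval Pp hPp0 hcs hU).1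
  have hsPm : Summable fun n => c n * Pm.eval (x n) := (tsum_mul_eval Pm hPm0 hcs hU).1
  have hsA : Summable fun n => w n * (x n * (1 - x n)) := by
    refine Summable.of_nonneg_of_le (fun n => ?_) (fun n => ?_) (hws U⁻¹ (inv_pos.mpr hU))
    · exact mul_nonneg (hw n) (mul_nonneg (hxmem n).1 (by linarith [(hxmem n).2]))
    · rw [← hexp1]
      refine mul_le_mul_of_nonneg_left ?_ (hw n)
      nlinarith [(hxmem n).1, (hxmem n).2]
  have hsK : Summable fun n => w n * chiK ε (x n) := by
    refine Summable.of_nonneg_of_le (fun n => mul_nonneg (hw n) (chiK_nonneg _ _)) (fun n => ?_)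
      ((hws 1 one_pos).mul_right (Real.exp ((1 + ε) * U)))
    rw [hx, chiK_xU hU]
    split_ifs with h
    · rw [mul_one, mul_assoc, ← Real.exp_add]
      have : 1 ≤ Real.exp (-(1 * lam n) + (1 + ε) * U) := Real.one_le_exp_iff.mpr (by linarith)
      nlinarith [hw n]
    · rw [mul_zero]
      exact mul_nonneg (mul_nonneg (hw n) (Real.exp_pos _).le) (Real.exp_pos _).le
  -- pointwise sandwich
  have hup : ∀ n, c n * chiJ (x n) ≤
      c n * Pp.eval (x n) + ε * (w n * (x n * (1 - x n))) + 5 * (w n * chiK ε (x n)) := by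
    intro n
    obtain ⟨-, h2, -, h4⟩ := hP (x n) (hxmem n)
    rw [abs_le] at h4
    have hd : 0 ≤ Pp.eval (x n) - chiJ (x n) := by linarith
    have := hcw n
    have := hw n
    nlinarith
  have hlo : ∀ n, c n * Pm.eval (x n) - ε * (w n * (x n * (1 - x n))) - 5 * (w n * chiK ε (x n))
      ≤ c n * chiJ (x n) := by
    intro n
    obtain ⟨h1, -, h3, -⟩ := hP (x n) (hxmem n)
    rw [abs_le] at h3
    have hd : 0 ≤ chiJ (x n) - Pm.eval (x n) := by linarith
    have := hcw n
    have := hw n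
    nlinarith
  -- sum the sandwich
  have hA : ∑' n, w n * (x n * (1 - x n)) ≤ C₁ * U ^ β := hE1U
  have hK : ∑' n, w n * chiK ε (x n) ≤ C₁ * ε * U ^ β := hSK ▸ hE2U
  have hUp : (∑' n, c n * chiJ (x n)) ≤
      (∑' n, c n * Pp.eval (x n)) + ε * (C₁ * U ^ β) + 5 * (C₁ * ε * U ^ β) := by
    calc (∑' n, c n * chiJ (x n))
        ≤ ∑' n, (c n * Pp.eval (x n) + ε * (w n * (x n * (1 - x n))) + 5 * (w n * chiK ε (x n))) :=
          Summable.tsum_le_tsum hup hsJ ((hsPp.add (hsA.mul_left _)).add (hsK.mul_left _))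
      _ = (∑' n, c n * Pp.eval (x n)) + ε * ∑' n, w n * (x n * (1 - x n)) +
            5 * ∑' n, w n * chiK ε (x n) := by
          rw [Summable.tsum_add (hsPp.add (hsA.mul_left _)) (hsK.mul_left _),
            Summable.tsum_add hsPp (hsA.mul_left _), tsum_mul_left, tsum_mul_left]
      _ ≤ _ := by gcongr
  have hLo : (∑' n, c n * Pm.eval (x n)) - ε * (C₁ * U ^ β) - 5 * (C₁ * ε * U ^ β) ≤
      ∑' n, c n * chiJ (x n) := by
    calc (∑' n, c n * Pm.eval (x n)) - ε * (C₁ * U ^ β) - 5 * (C₁ * ε * U ^ β)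
        ≤ (∑' n, c n * Pm.eval (x n)) - ε * ∑' n, w n * (x n * (1 - x n)) -
            5 * ∑' n, w n * chiK ε (x n) := by gcongr
      _ = ∑' n, (c n * Pm.eval (x n) - ε * (w n * (x n * (1 - x n))) -
            5 * (w n * chiK ε (x n))) := by
          rw [Summable.tsum_sub (hsPm.sub (hsA.mul_left _)) (hsK.mul_left _),
            Summable.tsum_sub hsPm (hsA.mul_left _), tsum_mul_left, tsum_mul_left]
      _ ≤ _ := Summable.tsum_le_tsum hlo ((hsPm.sub (hsA.mul_left _)).sub (hsK.mul_left _)) hsJ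
  -- divide by U^β
  rw [hSJ]
  have hTp' : (∑' n, c n * Pp.eval (x n)) < η / 8 * U ^ β := by
    have := hTpU.2; rwa [div_lt_iff₀ hUβ] at this
  have hTm' : -(η / 8) * U ^ β < ∑' n, c n * Pm.eval (x n) := by
    have := hTmU.1; rwa [lt_div_iff₀ hUβ] at this
  constructor
  · rw [lt_div_iff₀ hUβ]
    nlinarith
  · rw [div_lt_iff₀ hUβ]
    nlinarith

end Literature.NumberTheory.LFunctions
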